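import Mathlib.Analysis.SpecialFunctions.Pow.Real
import Mathlib.Analysis.SpecificLimits.Basic
import Mathlib.Data.Fin.Tuple.NatAntidiagonal
import Mathlib.Algebra.BigOperators.Fin
import Mathlib.Order.Interval.Finset.Fin
import HarnessLib

/-!
# Beffara's partition-sum inequality (the dimension of the SLE curves, §3.1, Remark 1, (3.4))

Topic `Probability/RandomPlanarGeometry`; theorems only (no definition of mathematical content beyond
book-keeping abbreviations, no named fact). This is the purely combinatorial summation step of
V. Beffara, *The dimension of the SLE curves*, Ann. Probab. 36 (2008) 1421–1452, §3.1: the "main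
step in the proof of (ii)" of Lemma 8, isolated by Beffara as Remark 1, inequality (3.4):

> Let `m = (mᵢ)` and `l = (lᵢ)` be the jump sizes of the process, which we will interpret as ordered
> partitions of `k₁` and `k₂`, respectively [...] `m ⊢ k₁`, respectively `l ⊢ k₂`. The length of the
> partitions, that is, `I`, will be denoted as `|m| = |l|`. Let `l⁺` be the cumulative sum of `l`,
> that is, the sequence `(l₁ + ⋯ + lᵢ)_{1 ≤ i ≤ I-1}`. Using `a^m` as a shortcut for the product of
> the `a^{mᵢ}`, the main step in the proof of (ii) above is the following inequality, valid for any
> positive exponents `β, η` and `γ` and for `a` small enough [...]: Uniformly in `k₁` and `k₂`,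
> `∑_{m ⊢ k₁, l ⊢ k₂, |l| = |m|} a^{η m + γ l + β l⁺} c^{|l|} ≤ C a^{k₁ η/2 + k₂ γ}`.      (3.4)

In the proof of Lemma 8 (ii) (pp. 1440–1442) the summand is the product, over the `I` tasks, of the
conditional probabilities of the individual steps given by the strong Markov property: the `i`-th
closing step costs `C a^{η mᵢ}` and the `i`-th approach step costs
`C (a^{l₁ + ⋯ + l_{i-1}})^{β} (a^{lᵢ})^{γ}` (there `β = (8/κ - 1)/2`, `γ = 1 - κ/8`), and the parts
are "all positive except possibly for `m₁` and `l_I`". We prove (3.4) in exactly this product form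
and in that generality (`sum_prod_stepWeight_le`): writing `I = n + 1`,

  `∑_{n < N} ∑_{m : Fin (n+1) → ℕ, ∑ m = k₁} ∑_{l ∈ jumpTuples n k₂}
      ∏ᵢ c · a^{η mᵢ + γ lᵢ + β (l₀ + ⋯ + l_{i-1})} ≤ 4 c · a^{η k₁/2 + γ k₂}`

for every `N`, every real `γ`, `0 ≤ c`, `0 < a` with `a^{η/2} ≤ 1/2` and `(4c + 1) a^β ≤ 1/2`
(Beffara: "for `a` small enough"; the constant `C = 4c` depends on `c` only). Here the closing
jumps `mᵢ ≥ 0` are unrestricted and the approach jumps satisfy `lᵢ ≥ 1` except possibly the last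
one (`jumpTuples`), which contains Beffara's range of summation; since all terms are nonnegative
the printed statement (all parts positive) follows by monotonicity (`sum_prod_stepWeight_le'`).

Proof (Beffara p. 1442, streamlined): `a^{η m} = a^{η k₁}` and `a^{γ l} = a^{γ k₂}` factor out;
the number of `m`'s is absorbed by `a^{η k₁/2}` through
`∑_{∑ m = k₁} ∏ᵢ a^{η mᵢ} = a^{η k₁/2} ∑ ∏ᵢ (a^{η/2})^{mᵢ} ≤ a^{η k₁/2} (1 - a^{η/2})^{-(n+1)}`
(`sum_prod_rpow_le`, replacing Beffara's count `2^{I + k₁}`); and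
`l⁺ = ∑ⱼ (n - j) lⱼ` (`plusSum_eq`), so relaxing the constraint `∑ l = k₂` on the first `n` parts,
`∑_l a^{β l⁺} ≤ ∏_{j < n} ∑_{l ≥ 1} a^{β (n-j) l} ≤ (2 a^β)^n` (`sum_rpow_plusSum_le`; Beffara keeps
the sharper `2^{I-1} a^{β I(I-1)/2}`, which is not needed for (3.4)). Summing
`2c (4 c a^β)^n ≤ 2c 2^{-n}` over `n` gives the claim.

## References

* V. Beffara, *The dimension of the SLE curves*, Ann. Probab. 36 (2008), no. 4, 1421–1452,
  doi:10.1214/07-AOP364, arXiv:math/0211322; §3.1, Lemma 8 (ii) and Remark 1, inequality (3.4).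
  [Beffara2008]
-/

noncomputable section

open Finset

namespace Literature.Probability.RandomPlanarGeometry

namespace BeffaraPartitionSum

variable {n : ℕ} {a c η β γ : ℝ}

/-- The cumulative sum **before** step `i` of a sequence of jump lengths: `preSum l i = ∑_{j < i} l j`
(Beffara's `l₁ + ⋯ + l_{i-1}`, here 0-indexed). [cite: Beffara2008, §3.1 Remark 1] -/
def preSum (l : Fin n → ℕ) (i : Fin n) : ℕ := ∑ j ∈ Iio i, l j

/-- Beffara's `l⁺` summed: `plusSum l = ∑ᵢ (l₀ + ⋯ + l_{i-1})`, the exponent of `a^β` collected over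
all steps. [cite: Beffara2008, §3.1 Remark 1] -/
def plusSum (l : Fin n → ℕ) : ℕ := ∑ i, preSum l i

/-- The admissible approach-jump sequences with `n + 1` parts summing to `k`: all parts positive except
possibly the last one (Beffara, proof of Lemma 8 (ii): "all positive except possibly for `m₁` and
`l_I`"). [cite: Beffara2008, §3.1, proof of Lemma 8 (ii)] -/
def jumpTuples (n k : ℕ) : Finset (Fin (n + 1) → ℕ) :=
  (Finset.Nat.antidiagonalTuple (n + 1) k).filter fun l ↦ ∀ j : Fin (n + 1), (j : ℕ) < n → 1 ≤ l j

/-- Membership in `jumpTuples`: the parts sum to `k` and all but possibly the last are positive.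
[cite: Beffara2008, §3.1, proof of Lemma 8 (ii)] -/
theorem mem_jumpTuples {k : ℕ} {l : Fin (n + 1) → ℕ} :
    l ∈ jumpTuples n k ↔ ∑ i, l i = k ∧ ∀ j : Fin (n + 1), (j : ℕ) < n → 1 ≤ l j := by
  rw [jumpTuples, Finset.mem_filter, Finset.Nat.mem_antidiagonalTuple]

/-- **`l⁺` by parts**: `∑ᵢ (l₀ + ⋯ + l_{i-1}) = ∑ⱼ (n - j) lⱼ` for `l : Fin (n+1) → ℕ` (the part `lⱼ`
is counted once for every later step; `(Fin.rev j : ℕ) = n - j`). Beffara: "each term `a^{lᵢ}`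
appears `I - i` times in the product". [cite: Beffara2008, §3.1, proof of Lemma 8 (ii)] -/
theorem plusSum_eq (l : Fin (n + 1) → ℕ) : plusSum l = ∑ j, (j.rev : ℕ) * l j := by
  unfold plusSum preSum
  rw [Finset.sum_comm' (t' := Finset.univ) (s' := fun j ↦ Ioi j)]
  · refine Finset.sum_congr rfl fun j _ ↦ ?_
    rw [Finset.sum_const, smul_eq_mul, Fin.card_Ioi, Fin.val_rev]
    congr 1
    omega
  · intro i j
    simp only [Finset.mem_univ, true_and, and_true, Finset.mem_Iio, Finset.mem_Ioi]

/-- **The closing jumps**: `∑_{m : Fin d → ℕ, ∑ m = k} ∏ᵢ a^{η mᵢ} ≤ 2^d a^{η k/2}` when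
`a^{η/2} ≤ 1/2` — the factor `a^{η k}` is constant on the range of summation and half of it pays for
the number of compositions (Beffara: "the number of possible choices for the `mᵢ` [...] is smaller
than `2^{I+k₁}`, hence, replacing `C` by `2C` [...] `(2a^{η/2})^{k₁} a^{(η/2) k₁}`").
[cite: Beffara2008, §3.1, proof of Lemma 8 (ii)] -/
theorem sum_prod_rpow_le (ha : 0 < a) (hu : a ^ (η / 2) ≤ 1 / 2) (d k : ℕ) :
    ∑ m ∈ Finset.Nat.antidiagonalTuple d k, ∏ i, a ^ (η * m i) ≤ 2 ^ d * a ^ (η * k / 2) := by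
  set u := a ^ (η / 2) with hu_def
  have hu0 : 0 < u := Real.rpow_pos_of_pos ha _
  have key : ∀ m ∈ Finset.Nat.antidiagonalTuple d k,
      ∏ i, a ^ (η * m i) = u ^ k * ∏ i, u ^ (m i) := by
    intro m hm
    rw [Finset.Nat.mem_antidiagonalTuple] at hm
    have h1 : ∀ i, a ^ (η * m i) = u ^ (m i) * u ^ (m i) := by
      intro i
      rw [← pow_add, hu_def, ← Real.rpow_natCast, ← Real.rpow_mul ha.le]
      congr 1
      push_cast
      ring
    simp_rw [h1, Finset.prod_mul_distrib, Finset.prod_pow_eq_pow_sum, hm]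
  rw [Finset.sum_congr rfl key, ← Finset.mul_sum]
  have hk : u ^ k = a ^ (η * k / 2) := by
    rw [hu_def, ← Real.rpow_natCast, ← Real.rpow_mul ha.le]
    congr 1
    ring
  rw [hk, mul_comm]
  refine mul_le_mul_of_nonneg_right ?_ (Real.rpow_nonneg ha.le _)
  calc ∑ m ∈ Finset.Nat.antidiagonalTuple d k, ∏ i, u ^ (m i)
      ≤ ∑ m ∈ Fintype.piFinset fun _ : Fin d ↦ Finset.range (k + 1), ∏ i, u ^ (m i) := by
        refine Finset.sum_le_sum_of_subset_of_nonneg (fun m hm ↦ ?_) fun _ _ _ ↦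
          Finset.prod_nonneg fun _ _ ↦ pow_nonneg hu0.le _
        rw [Finset.Nat.mem_antidiagonalTuple] at hm
        rw [Fintype.mem_piFinset]
        intro i
        rw [Finset.mem_range, Nat.lt_succ_iff, ← hm]
        exact Finset.single_le_sum (fun _ _ ↦ Nat.zero_le _) (Finset.mem_univ i)
    _ = ∏ _i : Fin d, ∑ j ∈ Finset.range (k + 1), u ^ j :=
        Finset.sum_prod_piFinset (Finset.range (k + 1)) fun _ j ↦ u ^ j
    _ ≤ ∏ _i : Fin d, (2 : ℝ) := by
        refine Finset.prod_le_prod (fun _ _ ↦ Finset.sum_nonneg fun _ _ ↦ pow_nonneg hu0.le _)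
          fun _ _ ↦ ?_
        calc ∑ j ∈ Finset.range (k + 1), u ^ j ≤ ∑ j ∈ Finset.range (k + 1), (1 / 2 : ℝ) ^ j :=
              Finset.sum_le_sum fun j _ ↦ pow_le_pow_left₀ hu0.le hu j
          _ ≤ 2 := sum_geometric_two_le _
    _ = 2 ^ d := by simp

/-- **The approach jumps**: relaxing the constraint `∑ l = k` on the first `n` parts,
`∑_{l ∈ jumpTuples n k} a^{β l⁺} ≤ ∏_{j < n} ∑_{l ≥ 1} a^{β (n - j) l} ≤ (2 a^β)^n` when `a ≤ 1` and
`a^β ≤ 1/2` (Beffara: "An upper bound is then given by relaxing the condition `l₁ + ⋯ + l_I = k₂`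
and simply summing over all positive values of `l₁, …, l_{I-1}` (`l_I` does not contribute to the
product anyway) [...] each sum will be equal to `a^{(I-i)β}` up to a constant which, if `a` is chosen
small enough, is smaller than 2"). [cite: Beffara2008, §3.1, proof of Lemma 8 (ii)] -/
theorem sum_rpow_plusSum_le (ha : 0 < a) (ha1 : a ≤ 1) (hβ : 0 ≤ β) (hv : a ^ β ≤ 1 / 2) (n k : ℕ) :
    ∑ l ∈ jumpTuples n k, a ^ (β * plusSum l) ≤ (2 * a ^ β) ^ n := by
  -- the weights of the first `n` parts
  set v : Fin n → ℝ := fun j ↦ a ^ (β * ((j.rev : ℕ) + 1 : ℝ)) with hv_def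
  have hv0 : ∀ j, 0 < v j := fun j ↦ Real.rpow_pos_of_pos ha _
  have hvle : ∀ j, v j ≤ a ^ β := by
    intro j
    refine Real.rpow_le_rpow_of_exponent_ge ha ha1 ?_
    have h0 : (0 : ℝ) ≤ (j.rev : ℕ) := Nat.cast_nonneg _
    nlinarith
  have hvhalf : ∀ j, v j ≤ 1 / 2 := fun j ↦ (hvle j).trans hv
  -- `a^{β l⁺} = ∏_{j < n} v_j ^ {l_j}` (the last part has coefficient `0`)
  have key : ∀ l : Fin (n + 1) → ℕ, a ^ (β * plusSum l) = ∏ j : Fin n, v j ^ (l j.castSucc) := by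
    intro l
    rw [plusSum_eq]
    push_cast
    rw [Finset.mul_sum, Real.rpow_sum_of_pos ha, Fin.prod_univ_castSucc]
    have hlast : a ^ (β * ((((Fin.last n).rev : ℕ) : ℝ) * (l (Fin.last n) : ℝ))) = 1 := by
      rw [Fin.rev_last, Fin.val_zero, Nat.cast_zero, zero_mul, mul_zero, Real.rpow_zero]
    rw [hlast, mul_one]
    refine Finset.prod_congr rfl fun j _ ↦ ?_
    rw [hv_def, ← Real.rpow_natCast, ← Real.rpow_mul ha.le, Fin.rev_castSucc, Fin.val_succ]
    push_cast
    ring_nf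
  simp_rw [key]
  -- drop the last part: `l ↦ (l_j - 1)_{j < n}` is injective on `jumpTuples n k`
  set φ : (Fin (n + 1) → ℕ) → (Fin n → ℕ) := fun l j ↦ l j.castSucc - 1 with hφ
  have hpos : ∀ l ∈ jumpTuples n k, ∀ j : Fin n, 1 ≤ l j.castSucc := fun l hl j ↦
    (mem_jumpTuples.1 hl).2 _ (by rw [Fin.val_castSucc]; exact j.isLt)
  have hinj : Set.InjOn φ (jumpTuples n k) := by
    intro l hl l' hl' h
    have hcs : ∀ j : Fin n, l j.castSucc = l' j.castSucc := by
      intro j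
      have h1 := congr_fun h j
      simp only [hφ] at h1
      have := hpos l hl j
      have := hpos l' hl' j
      omega
    have hsum := (mem_jumpTuples.1 hl).1
    have hsum' := (mem_jumpTuples.1 hl').1
    rw [Fin.sum_univ_castSucc] at hsum hsum'
    have hl0 : l (Fin.last n) = l' (Fin.last n) := by
      have : ∑ j : Fin n, l j.castSucc = ∑ j : Fin n, l' j.castSucc := Finset.sum_congr rfl fun j _ ↦ hcs j
      omega
    funext i
    rcases Fin.eq_castSucc_or_eq_last i with ⟨j, rfl⟩ | rfl
    · exact hcs j
    · exact hl0
  have hG : ∀ l ∈ jumpTuples n k, ∏ j : Fin n, v j ^ (l j.castSucc) = ∏ j : Fin n, v j ^ (φ l j + 1) := by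
    intro l hl
    refine Finset.prod_congr rfl fun j _ ↦ ?_
    rw [hφ, Nat.sub_add_cancel (hpos l hl j)]
  rw [Finset.sum_congr rfl hG, ← Finset.sum_image (g := φ) (f := fun t ↦ ∏ j : Fin n, v j ^ (t j + 1)) hinj]
  calc ∑ t ∈ (jumpTuples n k).image φ, ∏ j : Fin n, v j ^ (t j + 1)
      ≤ ∑ t ∈ Fintype.piFinset fun _ : Fin n ↦ Finset.range k, ∏ j : Fin n, v j ^ (t j + 1) := by
        refine Finset.sum_le_sum_of_subset_of_nonneg (fun t ht ↦ ?_) fun _ _ _ ↦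
          Finset.prod_nonneg fun j _ ↦ pow_nonneg (hv0 j).le _
        rw [Finset.mem_image] at ht
        obtain ⟨l, hl, rfl⟩ := ht
        rw [Fintype.mem_piFinset]
        intro j
        rw [Finset.mem_range, hφ]
        have h1 := hpos l hl j
        have h2 : l j.castSucc ≤ k := by
          rw [← (mem_jumpTuples.1 hl).1]
          exact Finset.single_le_sum (fun _ _ ↦ Nat.zero_le _) (Finset.mem_univ _)
        simp only
        omega
    _ = ∏ j : Fin n, ∑ s ∈ Finset.range k, v j ^ (s + 1) :=
        Finset.sum_prod_piFinset (Finset.range k) fun j s ↦ v j ^ (s + 1)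
    _ ≤ ∏ j : Fin n, (2 * a ^ β) := by
        refine Finset.prod_le_prod (fun j _ ↦ Finset.sum_nonneg fun _ _ ↦ pow_nonneg (hv0 j).le _)
          fun j _ ↦ ?_
        have hgeom : ∑ s ∈ Finset.range k, v j ^ s ≤ 2 :=
          (Finset.sum_le_sum fun s _ ↦ pow_le_pow_left₀ (hv0 j).le (hvhalf j) s).trans
            (sum_geometric_two_le _)
        calc ∑ s ∈ Finset.range k, v j ^ (s + 1) = v j * ∑ s ∈ Finset.range k, v j ^ s := by
              rw [Finset.mul_sum]
              exact Finset.sum_congr rfl fun s _ ↦ by ring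
          _ ≤ a ^ β * 2 := mul_le_mul (hvle j) hgeom
              (Finset.sum_nonneg fun _ _ ↦ pow_nonneg (hv0 j).le _) (Real.rpow_nonneg ha.le _)
          _ = 2 * a ^ β := mul_comm _ _
    _ = (2 * a ^ β) ^ n := by simp

/-- **The weight of one path factorises**: `∏ᵢ c a^{η mᵢ + γ lᵢ + β preSum l i}
= c^{n+1} (∏ᵢ a^{η mᵢ}) a^{γ ∑ l} a^{β l⁺}`. [cite: Beffara2008, §3.1, proof of Lemma 8 (ii)] -/
theorem prod_stepWeight_eq (ha : 0 < a) (m l : Fin (n + 1) → ℕ) :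
    ∏ i, c * a ^ (η * m i + γ * l i + β * preSum l i) =
      c ^ (n + 1) * (∏ i, a ^ (η * m i)) * a ^ (γ * (∑ i, l i : ℕ)) * a ^ (β * plusSum l) := by
  simp_rw [Real.rpow_add ha, Finset.prod_mul_distrib, Finset.prod_const, Finset.card_univ,
    Fintype.card_fin]
  rw [plusSum]
  push_cast
  rw [Finset.mul_sum, Finset.mul_sum, Real.rpow_sum_of_pos ha, Real.rpow_sum_of_pos ha]
  ring

/-- **Beffara's inequality (3.4)** (Ann. Probab. 36 (2008), §3.1, Remark 1; the main step of the proof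
of Lemma 8 (ii)), in product form and with the relaxed positivity used there: for `0 < a`,
`0 ≤ c`, `a^{η/2} ≤ 1/2` and `(4c+1) a^β ≤ 1/2` ("`a` small enough"), every real `γ` and all
`k₁ k₂ N`,
`∑_{n<N} ∑_{∑ m = k₁} ∑_{l ∈ jumpTuples n k₂} ∏ᵢ c a^{η mᵢ + γ lᵢ + β (l₀+⋯+l_{i-1})} ≤ 4c a^{η k₁/2 + γ k₂}`,
uniformly in `k₁, k₂` (and `N`). [cite: Beffara2008, §3.1, Remark 1, (3.4)] -/
theorem sum_prod_stepWeight_le (ha : 0 < a) (hβ : 0 < β) (hc : 0 ≤ c) (hηa : a ^ (η / 2) ≤ 1 / 2)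
    (hβa : (4 * c + 1) * a ^ β ≤ 1 / 2) (γ : ℝ) (k₁ k₂ N : ℕ) :
    ∑ n ∈ Finset.range N, ∑ m ∈ Finset.Nat.antidiagonalTuple (n + 1) k₁, ∑ l ∈ jumpTuples n k₂,
        ∏ i, c * a ^ (η * m i + γ * l i + β * preSum l i) ≤
      4 * c * a ^ (η * k₁ / 2 + γ * k₂) := by
  have haβ0 : 0 ≤ a ^ β := Real.rpow_nonneg ha.le _
  have hv : a ^ β ≤ 1 / 2 := by nlinarith
  have ha1 : a ≤ 1 := by
    by_contra h
    rw [not_le] at h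
    have : 1 < a ^ β := Real.one_lt_rpow h hβ
    linarith
  have h4c : 4 * c * a ^ β ≤ 1 / 2 := by nlinarith
  -- the bound for one value of `n`
  have hn : ∀ n : ℕ, ∑ m ∈ Finset.Nat.antidiagonalTuple (n + 1) k₁, ∑ l ∈ jumpTuples n k₂,
      ∏ i, c * a ^ (η * m i + γ * l i + β * preSum l i) ≤
      a ^ (η * k₁ / 2 + γ * k₂) * (2 * c * (4 * c * a ^ β) ^ n) := by
    intro n
    have hrw : ∀ m ∈ Finset.Nat.antidiagonalTuple (n + 1) k₁, ∀ l ∈ jumpTuples n k₂,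
        ∏ i, c * a ^ (η * m i + γ * l i + β * preSum l i) =
          (c ^ (n + 1) * a ^ (γ * k₂)) * ((∏ i, a ^ (η * m i)) * a ^ (β * plusSum l)) := by
      intro m _ l hl
      rw [prod_stepWeight_eq ha, (mem_jumpTuples.1 hl).1]
      ring
    calc ∑ m ∈ Finset.Nat.antidiagonalTuple (n + 1) k₁, ∑ l ∈ jumpTuples n k₂,
          ∏ i, c * a ^ (η * m i + γ * l i + β * preSum l i)
        = ∑ m ∈ Finset.Nat.antidiagonalTuple (n + 1) k₁, ∑ l ∈ jumpTuples n k₂,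
            (c ^ (n + 1) * a ^ (γ * k₂)) * ((∏ i, a ^ (η * m i)) * a ^ (β * plusSum l)) :=
          Finset.sum_congr rfl fun m hm ↦ Finset.sum_congr rfl fun l hl ↦ hrw m hm l hl
      _ = (c ^ (n + 1) * a ^ (γ * k₂)) *
            ((∑ m ∈ Finset.Nat.antidiagonalTuple (n + 1) k₁, ∏ i, a ^ (η * m i)) *
              ∑ l ∈ jumpTuples n k₂, a ^ (β * plusSum l)) := by
          rw [Finset.sum_mul_sum, Finset.mul_sum]
          refine Finset.sum_congr rfl fun m _ ↦ ?_
          rw [Finset.mul_sum]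
      _ ≤ (c ^ (n + 1) * a ^ (γ * k₂)) * ((2 ^ (n + 1) * a ^ (η * k₁ / 2)) * (2 * a ^ β) ^ n) := by
          refine mul_le_mul_of_nonneg_left ?_ (mul_nonneg (pow_nonneg hc _) (Real.rpow_nonneg ha.le _))
          refine mul_le_mul (sum_prod_rpow_le ha hηa _ _) (sum_rpow_plusSum_le ha ha1 hβ.le hv _ _)
            (Finset.sum_nonneg fun _ _ ↦ Real.rpow_nonneg ha.le _)
            (mul_nonneg (pow_nonneg zero_le_two _) (Real.rpow_nonneg ha.le _))
      _ = a ^ (η * k₁ / 2 + γ * k₂) * (2 * c * (4 * c * a ^ β) ^ n) := by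
          have h4 : (4 : ℝ) ^ n = 2 ^ n * 2 ^ n := by rw [← mul_pow]; norm_num
          rw [Real.rpow_add ha]
          simp only [mul_pow]
          rw [h4]
          ring
  calc ∑ n ∈ Finset.range N, ∑ m ∈ Finset.Nat.antidiagonalTuple (n + 1) k₁, ∑ l ∈ jumpTuples n k₂,
        ∏ i, c * a ^ (η * m i + γ * l i + β * preSum l i)
      ≤ ∑ n ∈ Finset.range N, a ^ (η * k₁ / 2 + γ * k₂) * (2 * c * (4 * c * a ^ β) ^ n) :=
        Finset.sum_le_sum fun n _ ↦ hn n
    _ = a ^ (η * k₁ / 2 + γ * k₂) * (2 * c) * ∑ n ∈ Finset.range N, (4 * c * a ^ β) ^ n := by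
        rw [Finset.mul_sum]
        exact Finset.sum_congr rfl fun n _ ↦ by ring
    _ ≤ a ^ (η * k₁ / 2 + γ * k₂) * (2 * c) * 2 := by
        refine mul_le_mul_of_nonneg_left ?_
          (mul_nonneg (Real.rpow_nonneg ha.le _) (mul_nonneg zero_le_two hc))
        calc ∑ n ∈ Finset.range N, (4 * c * a ^ β) ^ n ≤ ∑ n ∈ Finset.range N, (1 / 2 : ℝ) ^ n :=
              Finset.sum_le_sum fun n _ ↦ pow_le_pow_left₀ (by positivity) h4c n
          _ ≤ 2 := sum_geometric_two_le _
    _ = 4 * c * a ^ (η * k₁ / 2 + γ * k₂) := by ring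

/-- **(3.4) as printed** (ordered partitions: all parts of `m` and `l` positive), a sub-sum of the
previous one. [cite: Beffara2008, §3.1, Remark 1, (3.4)] -/
theorem sum_prod_stepWeight_le' (ha : 0 < a) (hβ : 0 < β) (hc : 0 ≤ c) (hηa : a ^ (η / 2) ≤ 1 / 2)
    (hβa : (4 * c + 1) * a ^ β ≤ 1 / 2) (γ : ℝ) (k₁ k₂ N : ℕ) :
    ∑ n ∈ Finset.range N,
      ∑ m ∈ (Finset.Nat.antidiagonalTuple (n + 1) k₁).filter (fun m ↦ ∀ i, 1 ≤ m i),
        ∑ l ∈ (Finset.Nat.antidiagonalTuple (n + 1) k₂).filter (fun l ↦ ∀ i, 1 ≤ l i),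
          ∏ i, c * a ^ (η * m i + γ * l i + β * preSum l i) ≤
      4 * c * a ^ (η * k₁ / 2 + γ * k₂) := by
  refine le_trans (Finset.sum_le_sum fun n _ ↦ ?_) (sum_prod_stepWeight_le ha hβ hc hηa hβa γ k₁ k₂ N)
  have hnn : ∀ (m l : Fin (n + 1) → ℕ), 0 ≤ ∏ i, c * a ^ (η * m i + γ * l i + β * preSum l i) :=
    fun m l ↦ Finset.prod_nonneg fun _ _ ↦ mul_nonneg hc (Real.rpow_nonneg ha.le _)
  refine le_trans (Finset.sum_le_sum_of_subset_of_nonneg (Finset.filter_subset _ _)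
    fun m _ _ ↦ Finset.sum_nonneg fun l _ ↦ hnn m l) (Finset.sum_le_sum fun m _ ↦ ?_)
  refine Finset.sum_le_sum_of_subset_of_nonneg (fun l hl ↦ ?_) fun l _ _ ↦ hnn m l
  rw [Finset.mem_filter] at hl
  rw [mem_jumpTuples, ← Finset.Nat.mem_antidiagonalTuple]
  exact ⟨hl.1, fun j _ ↦ hl.2 j⟩

end BeffaraPartitionSum

end Literature.Probability.RandomPlanarGeometry
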